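import Summits.NavierStokesRegularity.FunctionalMining.StretchingWrapFinal
import HarnessLib

/-!
# K1-Q1: the general wrap lemma `WrapLowerBound` holds

Cell `pub-nsfunc` (host summit NavierStokesRegularity, topic `FunctionalMining`), prove seat gen 5: the last typed node of
the dictionary seat's `StretchingNestedTargets.lean` (bank `K1Q1-HALF.md` Theorem 3 / §9.3, the WRAP LEMMA for an
arbitrary filler). **Search for candidate a priori estimates; no regularity claim.** Static facts about smooth
divergence-free fields on `T³`; nothing is asserted about Navier–Stokes.

For every smooth divergence-free `F` with `|Ω_F|² ≤ 1` and every `Λ ∈ (0, ½]`: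
`R(Λ;F) = [Λ(T₁₁ − T₂₂) + σ] / [2(Λ² + ℰ/2)] ≤ C⋆`. Proof from the landed nodes: potentials of `F` and of its
swap `x₁ ↔ x₂` (`Confinement.exists_potential`, `Swap12.*`), envelopes of the two boxes (`plateauEnvelope_holds`),
confinement (`confinementLemma_holds`), the wrap identity bound (`wrapIdentityBound_holds`) against every valid
constant `C`, and the limit `δ, ε′ → 0` done by contradiction with explicit tolerances.
-/

noncomputable section

open MeasureTheory Set Filter Topology Function
open scoped InnerProductSpace ContDiff

namespace Summit.NavierStokesRegularity.FunctionalMining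

open Literature.Analysis Literature.Analysis.FunctionSpaces Literature.Analysis.FunctionSpaces.Torus
open Literature.Analysis.FluidPDE Literature.Analysis.FluidPDE.Torus

namespace WrapFinal

open CellularStretching Confinement WrapStretching FillerMinus Swap12

/-- Real bookkeeping of the limit: if `½L ≤ 12δM + Kε′` with `δ ≤ L/(96(M+1))`, `Kε′ = L/8`, `M ≥ 0`, then `L ≤ 0`
is impossible for `L > 0` — stated as the contradiction. [folklore] -/
theorem limit_contra {L M K δ ε' : ℝ} (hL : 0 < L) (hM : 0 ≤ M) (hδ : δ ≤ L / (96 * (M + 1)))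
    (hKε : K * ε' = L / 8) (h : L / 2 ≤ 12 * δ * M + K * ε') : False := by
  have h1 : 12 * δ * M ≤ L / 8 := by
    have hM1 : 0 < M + 1 := by linarith
    calc 12 * δ * M ≤ 12 * (L / (96 * (M + 1))) * M := by
          apply mul_le_mul_of_nonneg_right (mul_le_mul_of_nonneg_left hδ (by norm_num)) hM
      _ = L / 8 * (M / (M + 1)) := by field_simp; ring
      _ ≤ L / 8 * 1 := mul_le_mul_of_nonneg_left ((div_le_one hM1).2 (by linarith)) (by linarith)
      _ = L / 8 := mul_one _
  linarith

/-- Products with a small deviation: `|I − ¼| ≤ 6δ ⇒ −6δ|T| ≤ T(I − ¼) ≤ 6δ|T|`. [folklore] -/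
theorem mul_dev_bounds {T I δ : ℝ} (h1 : 1 / 4 - 6 * δ ≤ I) (h2 : I ≤ 1 / 4) :
    -(|T| * (6 * δ)) ≤ T * (I - 1 / 4) ∧ T * (I - 1 / 4) ≤ |T| * (6 * δ) := by
  have h : |T * (I - 1 / 4)| ≤ |T| * (6 * δ) := by
    rw [abs_mul]; exact mul_le_mul_of_nonneg_left (abs_le.2 ⟨by linarith, by linarith⟩) (abs_nonneg _)
  exact abs_le.1 h

/-- **Real core of the limit argument**: the eight confinement approximations, the wrap identity bound and the
envelope sandwich `¼ − 6δ ≤ I ≤ ¼` give `½L ≤ 12δM + (4Λ+2+2C)ε′`. [ours; elementary] -/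
theorem real_core {Λ C δ ε' T1 T2 σ ℰ I2p I3p I2m I3m a1 a2 a3 a4 b1 b2 b3 b4 : ℝ}
    (hΛ : 0 ≤ Λ) (hC : 0 ≤ C) (hℰ : 0 ≤ ℰ)
    (key : Λ * (a1 - a2) + Λ * (b2 - b1) + a3 + b3 ≤ C * (Λ ^ 2 + a4 + b4))
    (e1 : |a1 - T1 * I2p| ≤ ε') (e2 : |a2 - T2 * I2p| ≤ ε') (e3 : |a3 - σ * I3p| ≤ ε') (e4 : |a4 - ℰ * I2p| ≤ ε')
    (f1 : |b1 - T2 * I2m| ≤ ε') (f2 : |b2 - T1 * I2m| ≤ ε') (f3 : |b3 - σ * I3m| ≤ ε') (f4 : |b4 - ℰ * I2m| ≤ ε')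
    (hI2p : 1 / 4 - 6 * δ ≤ I2p ∧ I2p ≤ 1 / 4) (hI3p : 1 / 4 - 6 * δ ≤ I3p ∧ I3p ≤ 1 / 4)
    (hI2m : 1 / 4 - 6 * δ ≤ I2m ∧ I2m ≤ 1 / 4) (hI3m : 1 / 4 - 6 * δ ≤ I3m ∧ I3m ≤ 1 / 4) :
    (Λ * (T1 - T2) + σ - 2 * C * (Λ ^ 2 + ℰ / 2)) / 2 ≤
      12 * δ * (Λ * (|T1| + |T2|) + |σ|) + (4 * Λ + 2 + 2 * C) * ε' := by
  have m1 := mul_le_mul_of_nonneg_left (abs_le.1 e1).1 hΛ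
  have m2 := mul_le_mul_of_nonneg_left (abs_le.1 e2).2 hΛ
  have m3 := (abs_le.1 e3).1
  have m4 := mul_le_mul_of_nonneg_left (abs_le.1 e4).2 hC
  have n1 := mul_le_mul_of_nonneg_left (abs_le.1 f1).2 hΛ
  have n2 := mul_le_mul_of_nonneg_left (abs_le.1 f2).1 hΛ
  have n3 := (abs_le.1 f3).1
  have n4 := mul_le_mul_of_nonneg_left (abs_le.1 f4).2 hC
  have r1 := mul_le_mul_of_nonneg_left (mul_dev_bounds (T := T1) hI2p.1 hI2p.2).1 hΛ
  have r2 := mul_le_mul_of_nonneg_left (mul_dev_bounds (T := T2) hI2p.1 hI2p.2).2 hΛ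
  have r3 := mul_le_mul_of_nonneg_left (mul_dev_bounds (T := T1) hI2m.1 hI2m.2).1 hΛ
  have r4 := mul_le_mul_of_nonneg_left (mul_dev_bounds (T := T2) hI2m.1 hI2m.2).2 hΛ
  have r5 := (mul_dev_bounds (T := σ) hI3p.1 hI3p.2).1
  have r6 := (mul_dev_bounds (T := σ) hI3m.1 hI3m.2).1
  have hCE : 0 ≤ C * ℰ := mul_nonneg hC hℰ
  have r7 := mul_le_mul_of_nonneg_left hI2p.2 hCE
  have r8 := mul_le_mul_of_nonneg_left hI2m.2 hCE
  linarith only [key, m1, m2, m3, m4, n1, n2, n3, n4, r1, r2, r3, r4, r5, r6, r7, r8, hΛ, hC, hℰ]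

/-- **The wrap inequality against a valid constant**: for smooth divergence-free `F` with `|Ω_F|² ≤ 1`,
`Λ ∈ (0, ½]` and every valid `C`: `Λ(T₁₁ − T₂₂)(F) + σ(F) ≤ 2C(Λ² + ℰ(F)/2)`. [ours] -/
theorem wrap_le_of_valid {F : UnitAddTorus (Fin 3) → EuclideanSpace ℝ (Fin 3)} (hF : IsSmooth F) (hdF : IsDivFree F)
    (hΩ : ∀ x, torusVorticitySqAt F x ≤ 1) {Λ : ℝ} (hΛ : 0 < Λ) (hΛ' : Λ ≤ 1 / 2) {C : ℝ}
    (hB : StretchingSupBound (d := Fin 3) C) :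
    Λ * (vorticityMoment F 1 1 - vorticityMoment F 2 2) + enstrophyProduction F ≤
      2 * C * (Λ ^ 2 + torusEnstrophy F / 2) := by
  have hC := hB.nonneg
  have hEF := torusEnstrophy_nonneg F
  by_contra hlt
  rw [not_le] at hlt
  obtain ⟨L, hLdef⟩ : ∃ L, L = Λ * (vorticityMoment F 1 1 - vorticityMoment F 2 2) + enstrophyProduction F -
      2 * C * (Λ ^ 2 + torusEnstrophy F / 2) := ⟨_, rfl⟩
  have hL : 0 < L := by rw [hLdef]; linarith
  obtain ⟨M, hMdef⟩ : ∃ M, M = Λ * (|vorticityMoment F 1 1| + |vorticityMoment F 2 2|) + |enstrophyProduction F| :=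
    ⟨_, rfl⟩
  have hM : 0 ≤ M := by rw [hMdef]; positivity
  obtain ⟨K, hKdef⟩ : ∃ K, K = 4 * Λ + 2 + 2 * C := ⟨_, rfl⟩
  have hK : 0 < K := by rw [hKdef]; linarith
  -- tolerances
  obtain ⟨δ, hδdef⟩ : ∃ δ : ℝ, δ = min (1 / 32) (L / (96 * (M + 1))) := ⟨_, rfl⟩
  have hδ : 0 < δ := by rw [hδdef]; exact lt_min (by norm_num) (by positivity)
  have hδ16 : δ < 1 / 16 := by rw [hδdef]; exact (min_le_left _ _).trans_lt (by norm_num)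
  have hδL : δ ≤ L / (96 * (M + 1)) := by rw [hδdef]; exact min_le_right _ _
  obtain ⟨ε', hε'def⟩ : ∃ ε' : ℝ, ε' = L / (8 * K) := ⟨_, rfl⟩
  have hε' : 0 < ε' := by rw [hε'def]; positivity
  have hKε : K * ε' = L / 8 := by rw [hε'def]; field_simp
  -- potentials of `F` and of its swap
  obtain ⟨A, hA, hAω, hAE, hAσ, hAT⟩ := exists_potential hF hdF
  obtain ⟨A', hA', hA'ω, hA'E, hA'σ, hA'T⟩ := exists_potential (isSmooth_swapField hF) (isDivFree_swapField hF hdF)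
  have hAω1 : ∀ x, torusVorticitySqAt (curlField A) x ≤ 1 := fun x => by rw [hAω]; exact hΩ x
  have hA'ω1 : ∀ x, torusVorticitySqAt (curlField A') x ≤ 1 := fun x => by
    rw [hA'ω, torusVorticitySqAt_swapField hF]; exact hΩ _
  obtain ⟨s0, s1, s2⟩ := sw_vals
  -- envelopes and confined fields
  obtain ⟨⟨Ep, hEps, hEp01, hEp0, hI3p, hI32p, hI2p⟩, ⟨Em, hEms, hEm01, hEm0, hI3m, hI32m, hI2m⟩⟩ :=
    plateauEnvelope_holds δ hδ hδ16
  obtain ⟨up, hup, hupd, hups, hupω, hupE, hupσ, hupT1, hupT2⟩ :=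
    confinementLemma_holds A hA hAω1 Ep hEps hEp01 ε' hε'
  obtain ⟨um, hum, humd, hums, humω, humE, humσ, humT1, humT2⟩ :=
    confinementLemma_holds A' hA' hA'ω1 Em hEms hEm01 ε' hε'
  have hups' : ∀ x ∉ boxPlus (2 * δ), up x = 0 := fun x hx =>
    hups (boxPlus (2 * δ))ᶜ (isClosed_boxPlus _).isOpen_compl (fun y hy => hEp0 y hy) x hx
  have hums' : ∀ x ∉ boxMinus (2 * δ), um x = 0 := fun x hx =>
    hums (boxMinus (2 * δ))ᶜ (isClosed_boxMinus _).isOpen_compl (fun y hy => hEm0 y hy) x hx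
  -- the wrap identity bound
  have key := wrapIdentityBound_holds Λ hΛ hΛ' δ hδ hδ16 up um hup hupd hum humd hups' hums' hupω humω C hC hB
  -- the filler statistics through `F`
  rw [hAE] at hupE
  rw [hAσ] at hupσ
  rw [hAT] at hupT1 hupT2
  rw [hA'E, torusEnstrophy_swapField hF hdF] at humE
  rw [hA'σ, enstrophyProduction_swapField hF hdF] at humσ
  rw [hA'T, vorticityMoment_swapField hF, s1] at humT1
  rw [hA'T, vorticityMoment_swapField hF, s2] at humT2
  -- the envelope sandwich
  have lo : 1 / 4 - 6 * δ ≤ (1 / 2 - 6 * δ) ^ 2 := by linarith only [sq_nonneg δ]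
  have hi : (1 / 2 - 4 * δ) ^ 2 ≤ 1 / 4 := by
    have h1 : 0 ≤ δ * (1 / 4 - δ) := mul_nonneg hδ.le (by linarith only [hδ16])
    linarith only [h1]
  have main := real_core hΛ.le hC hEF key hupT1 hupT2 hupσ hupE humT1 humT2 humσ humE
    ⟨(lo.trans hI3p).trans hI32p, hI2p.trans hi⟩ ⟨lo.trans hI3p, hI32p.trans (hI2p.trans hi)⟩
    ⟨(lo.trans hI3m).trans hI32m, hI2m.trans hi⟩ ⟨lo.trans hI3m, hI32m.trans (hI2m.trans hi)⟩
  rw [← hLdef, ← hMdef, ← hKdef] at main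
  exact limit_contra hL hM hδL hKε main

/-- **`WrapLowerBound` holds** (bank `K1Q1-HALF.md` Theorem 3 for an arbitrary filler): `R(Λ;F) ≤ C⋆` for every
smooth divergence-free `F` with `|Ω_F|² ≤ 1` and `Λ ∈ (0, ½]`. Search for candidate a priori estimates; no
regularity claim. [ours] -/
theorem wrapLowerBound_holds : WrapLowerBound := by
  intro F hF hdF hΩ Λ hΛ hΛ'
  have hD : 0 < 2 * (Λ ^ 2 + torusEnstrophy F / 2) := by
    have := torusEnstrophy_nonneg F; positivity
  refine le_csInf stretchingSupValid_nonempty fun C hC => ?_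
  rw [mem_stretchingSupValid] at hC
  rw [wrapRatio, div_le_iff₀ hD]
  have h := wrap_le_of_valid hF hdF hΩ hΛ hΛ' hC
  linarith

end WrapFinal

end Summit.NavierStokesRegularity.FunctionalMining

end
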